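import Literature.NumberTheory.LFunctions.ZetaMulMeanValue
import Mathlib.NumberTheory.EulerProduct.Basic
import Mathlib.NumberTheory.SmoothNumbers
import Mathlib.Analysis.SpecialFunctions.Pow.Real
import Literature.NumberTheory.LFunctions.MertensElementary
import HarnessLib

/-!
# The truncated Euler product of `ζ(s) L(s, χ)` at `s = 1` against the divisor-sum means
# `∑_{n ≤ x} (1 ∗ χ)(n)/n`: a smooth-number sandwich

Topic `Literature/NumberTheory/LFunctions`. Everything in this file is PROVED (theorems only).

For a quadratic Dirichlet character `χ` (so `(1 ∗ χ)(n) = ∑_{d ∣ n} χ(d) ≥ 0`, Mathlib's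
`DirichletCharacter.zetaMul_nonneg`; real-valuedness from the tree's
`Literature.NumberTheory.LFunctions.ZetaMul.zetaMul_im_eq_zero`) and `M ≥ 1` put
`Π_s(M) = ∏_{p < M} (1 − p^{−s})⁻¹ (1 − χ(p) p^{−s})⁻¹` (`s > 0` real) and
`S(x) = ∑_{n ≤ x} (1 ∗ χ)(n)/n`. Expanding the Euler factors,
`Π_s(M) = ∑_{m  M-smooth} (1 ∗ χ)(m) m^{−s}` (Mathlib's Euler product over smooth numbers,
`EulerProduct.summable_and_hasSum_smoothNumbers_prod_primesBelow_tsum`). Hence: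

* `sum_le_smoothProduct` — **lower bound**: `S(x) ≤ Π₁(M)` for `x < M` (every `n ≤ x` is
  `M`-smooth and all terms are `≥ 0`);
* `smoothProduct_le_sum_add` — **Rankin's trick**: `Π₁(M) ≤ S(Z) + Z^{−δ} Π_{1−δ}(M)` for
  `0 < δ < 1`, `Z ≥ 1` (for `m > Z`, `m^{−1} ≤ Z^{−δ} m^{−(1−δ)}`);
* `smoothProduct_rankin_le` — `Π_{1−δ}(M) ≤ e^{20} Π₁(M)` for `δ = 1/log M`, `M ≥ 55`
  (factorwise `≤ exp(10 δ log p/p)`, then Mertens' first theorem in Chebyshev's form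
  `∑_{p ≤ n} log p/p ≤ log n + log 4`, `Literature.NumberTheory.LFunctions.MertensBound.sum_log_div_prime_le`);
* `smoothProduct_le_sum_add_exp` — the **upper bound** used downstream:
  `Π₁(M) ≤ S(Z) + e^{20} Z^{−1/log M} Π₁(M)` (`M ≥ 55`, `Z ≥ 1`).

This is the elementary device by which Tao–Teräväinen-type positivity arguments control
truncated Euler products `∏_{p ≤ z}(1 − 1/p)⁻¹(1 − χ(p)/p)⁻¹` by the means `S(x)`, whose
asymptotic `S(x) = L'(1, χ) + (log x + γ) L(1, χ) + o(1)` (`x ≥ q^{1/2+ε}`) is classical; it is the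
sieve-free replacement of Granville–Mollin's (5.7) in the tree's discharge of
`Literature.Barriers.Parity.GranvilleMollin2000_prop2`.

## References

* T. Tao, J. Teräväinen, *The Hardy–Littlewood–Chowla conjecture in the presence of a Siegel
  zero*, J. London Math. Soc. (2) 106 (2022), §3 (proof of Proposition 3.5) [TaoTeravainen2021].
* R. A. Rankin, *The difference between consecutive prime numbers*, J. London Math. Soc. 13
  (1938) 242–247 (the `Z^{−δ} m^{δ}` device) [folklore].
-/

noncomputable section

open Finset Real Filter Topology

namespace Literature.NumberTheory.LFunctions.SmoothEulerProduct

variable {N : ℕ} (χ : DirichletCharacter ℂ N)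

/-! ### The coefficients `(1 ∗ χ)(n)` of `ζ(s) L(s, χ)` as real numbers -/

/-- The values of a quadratic character at naturals are `0`, `1` or `−1`. [folklore] -/
theorem apply_re_trichotomy (hχ : χ ^ 2 = 1) (n : ℕ) :
    (χ n).re = 0 ∨ (χ n).re = 1 ∨ (χ n).re = -1 := by
  rcases MulChar.isQuadratic_iff_sq_eq_one.mpr hχ (n : ZMod N) with h | h | h <;> simp [h]

/-- `|Re χ(n)| ≤ 1`. [folklore] -/
theorem abs_apply_re_le_one (n : ℕ) : |(χ n).re| ≤ 1 :=
  (Complex.abs_re_le_norm _).trans (DirichletCharacter.norm_le_one χ _)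

/-- For quadratic `χ` the value `χ(n)` is the real number `Re χ(n)`. [folklore] -/
theorem apply_eq_re (hχ : χ ^ 2 = 1) (n : ℕ) : χ n = (((χ n).re : ℝ) : ℂ) := by
  rcases MulChar.isQuadratic_iff_sq_eq_one.mpr hχ (n : ZMod N) with h | h | h <;> simp [h]

/-- `(1 ∗ χ)(n) ≥ 0` as a real number (Mathlib's `zetaMul_nonneg`). [folklore] -/
theorem zetaMul_re_nonneg (hχ : χ ^ 2 = 1) (n : ℕ) : 0 ≤ (χ.zetaMul n).re :=
  (Complex.nonneg_iff.mp (DirichletCharacter.zetaMul_nonneg hχ n)).1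

/-- `(1 ∗ χ)(1) = 1`. [folklore] -/
theorem zetaMul_one_re : (χ.zetaMul 1).re = 1 := by
  rw [χ.isMultiplicative_zetaMul.map_one, Complex.one_re]

/-- Multiplicativity of `Re (1 ∗ χ)` on coprime arguments. [folklore] -/
theorem zetaMul_re_mul (hχ : χ ^ 2 = 1) {m n : ℕ} (h : m.Coprime n) :
    (χ.zetaMul (m * n)).re = (χ.zetaMul m).re * (χ.zetaMul n).re := by
  rw [χ.isMultiplicative_zetaMul.map_mul_of_coprime h, Complex.mul_re,
    Literature.NumberTheory.LFunctions.ZetaMul.zetaMul_im_eq_zero χ hχ m, zero_mul, sub_zero]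

/-- `(1 ∗ χ)(p^k) = ∑_{i ≤ k} (Re χ(p))^i` at a prime power. [folklore] -/
theorem zetaMul_prime_pow_re (hχ : χ ^ 2 = 1) {p : ℕ} (hp : p.Prime) (k : ℕ) :
    (χ.zetaMul (p ^ k)).re = ∑ i ∈ range (k + 1), (χ p).re ^ i := by
  have h : χ.zetaMul (p ^ k) = ∑ i ∈ range (k + 1), χ (p : ZMod N) ^ i := by
    simp only [DirichletCharacter.zetaMul, toArithmeticFunction, ArithmeticFunction.coe_zeta_mul_apply,
      ArithmeticFunction.coe_mk, Nat.sum_divisors_prime_pow hp, pow_eq_zero_iff', hp.ne_zero, ne_eq,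
      false_and, ↓reduceIte, Nat.cast_pow, map_pow]
  rw [h, Complex.re_sum]
  refine sum_congr rfl fun i _ => ?_
  obtain ⟨r, hr⟩ : ∃ r : ℝ, χ (p : ZMod N) = r := ⟨_, apply_eq_re χ hχ p⟩
  rw [hr, ← Complex.ofReal_pow, Complex.ofReal_re, Complex.ofReal_re]

/-- Crude bound `(1 ∗ χ)(p^k) ≤ k + 1`. [folklore] -/
theorem zetaMul_prime_pow_re_le (hχ : χ ^ 2 = 1) {p : ℕ} (hp : p.Prime) (k : ℕ) :
    (χ.zetaMul (p ^ k)).re ≤ k + 1 := by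
  rw [zetaMul_prime_pow_re χ hχ hp]
  calc ∑ i ∈ range (k + 1), (χ p).re ^ i ≤ ∑ i ∈ range (k + 1), (1 : ℝ) := by
        refine sum_le_sum fun i _ => ?_
        calc (χ p).re ^ i ≤ |(χ p).re ^ i| := le_abs_self _
          _ = |(χ p).re| ^ i := abs_pow _ _
          _ ≤ 1 ^ i := pow_le_pow_left₀ (abs_nonneg _) (abs_apply_re_le_one χ p) i
          _ = 1 := one_pow _
    _ = k + 1 := by simp

/-! ### The local factors -/

/-- The geometric series identity behind the Euler factor of `ζ(s)L(s, χ)`: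
for `0 ≤ t < 1` and `|c| ≤ 1`, `∑_k (∑_{i ≤ k} c^i) t^k = (1 − t)⁻¹ (1 − c t)⁻¹`
(Cauchy product of `∑ (ct)^i` and `∑ t^j`). [folklore] -/
theorem hasSum_geom_conv {c t : ℝ} (hc : |c| ≤ 1) (ht0 : 0 ≤ t) (ht1 : t < 1) :
    HasSum (fun k : ℕ => (∑ i ∈ range (k + 1), c ^ i) * t ^ k) ((1 - t)⁻¹ * (1 - c * t)⁻¹) := by
  have hct : |c * t| < 1 := by
    rw [abs_mul, abs_of_nonneg ht0]
    calc |c| * t ≤ 1 * t := mul_le_mul_of_nonneg_right hc ht0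
      _ < 1 := by rw [one_mul]; exact ht1
  have hct' : ‖c * t‖ < 1 := by rwa [Real.norm_eq_abs]
  have ht' : ‖t‖ < 1 := by rwa [Real.norm_eq_abs, abs_of_nonneg ht0]
  have hf : Summable fun n : ℕ => ‖(c * t) ^ n‖ := by
    simp_rw [norm_pow]; exact summable_geometric_of_lt_one (norm_nonneg _) hct'
  have hg : Summable fun n : ℕ => ‖t ^ n‖ := by
    simp_rw [norm_pow]; exact summable_geometric_of_lt_one (norm_nonneg _) ht'
  have h := hasSum_sum_range_mul_of_summable_norm hf hg
  rw [tsum_geometric_of_norm_lt_one hct', tsum_geometric_of_norm_lt_one ht'] at h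
  have hfun : (fun n : ℕ => ∑ k ∈ range (n + 1), (c * t) ^ k * t ^ (n - k)) =
      fun k : ℕ => (∑ i ∈ range (k + 1), c ^ i) * t ^ k := by
    funext n
    rw [sum_mul]
    refine sum_congr rfl fun i hi => ?_
    have hi' : i ≤ n := Nat.lt_succ_iff.mp (mem_range.mp hi)
    rw [mul_pow, mul_assoc, ← pow_add, Nat.add_sub_cancel' hi']
  have hval : (1 - c * t)⁻¹ * (1 - t)⁻¹ = (1 - t)⁻¹ * (1 - c * t)⁻¹ := mul_comm _ _
  rw [hfun, hval] at h
  exact h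

/-- The Euler factor at `p` of `∑ (1 ∗ χ)(n) n^{−s}`, `s > 0`:
`∑_k (1 ∗ χ)(p^k) p^{−ks} = (1 − p^{−s})⁻¹ (1 − χ(p) p^{−s})⁻¹`. [folklore] -/
theorem hasSum_zetaMul_prime_pow (hχ : χ ^ 2 = 1) {p : ℕ} (hp : p.Prime) {s : ℝ} (hs : 0 < s) :
    HasSum (fun k : ℕ => (χ.zetaMul (p ^ k)).re * ((p ^ k : ℕ) : ℝ) ^ (-s))
      ((1 - (p : ℝ) ^ (-s))⁻¹ * (1 - (χ p).re * (p : ℝ) ^ (-s))⁻¹) := by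
  have hp1 : (1 : ℝ) < p := by exact_mod_cast hp.one_lt
  have hp0 : (0 : ℝ) < p := by linarith
  set t : ℝ := (p : ℝ) ^ (-s) with ht
  have ht0 : 0 ≤ t := Real.rpow_nonneg hp0.le _
  have ht1 : t < 1 := Real.rpow_lt_one_of_one_lt_of_neg hp1 (by linarith)
  have h := hasSum_geom_conv (abs_apply_re_le_one χ p) ht0 ht1
  convert h using 1
  funext k
  rw [zetaMul_prime_pow_re χ hχ hp k, ht, Nat.cast_pow, ← Real.rpow_natCast,
    ← Real.rpow_mul hp0.le, ← Real.rpow_natCast ((p : ℝ) ^ (-s)), ← Real.rpow_mul hp0.le]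
  ring_nf

/-- The Euler factor is `≥ 1`… in fact we only need: it is positive. For `s > 0` and `p` prime,
`0 < (1 − p^{−s})⁻¹ (1 − χ(p) p^{−s})⁻¹`. [folklore] -/
theorem eulerFactor_pos {p : ℕ} (hp : p.Prime) {s : ℝ} (hs : 0 < s) :
    0 < (1 - (p : ℝ) ^ (-s))⁻¹ * (1 - (χ p).re * (p : ℝ) ^ (-s))⁻¹ := by
  have hp1 : (1 : ℝ) < p := by exact_mod_cast hp.one_lt
  have hp0 : (0 : ℝ) < p := by linarith
  have ht0 : 0 ≤ (p : ℝ) ^ (-s) := Real.rpow_nonneg hp0.le _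
  have ht1 : (p : ℝ) ^ (-s) < 1 := Real.rpow_lt_one_of_one_lt_of_neg hp1 (by linarith)
  refine mul_pos (inv_pos.mpr (by linarith)) (inv_pos.mpr ?_)
  have : (χ p).re * (p : ℝ) ^ (-s) ≤ 1 * (p : ℝ) ^ (-s) :=
    mul_le_mul_of_nonneg_right ((le_abs_self _).trans (abs_apply_re_le_one χ p)) ht0
  linarith

/-! ### The Euler product over smooth numbers -/

/-- **`Π_s(M) = ∑_{m M-smooth} (1 ∗ χ)(m) m^{−s}`** for `s > 0`: the truncated Euler product of
`ζ(s) L(s, χ)` is the (absolutely convergent) sum of its Dirichlet coefficients over the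
`M`-smooth numbers. [folklore] -/
theorem hasSum_smooth (hχ : χ ^ 2 = 1) {s : ℝ} (hs : 0 < s) (M : ℕ) :
    HasSum (fun m : M.smoothNumbers => (χ.zetaMul m).re * ((m : ℕ) : ℝ) ^ (-s))
      (∏ p ∈ M.primesBelow, (1 - (p : ℝ) ^ (-s))⁻¹ * (1 - (χ p).re * (p : ℝ) ^ (-s))⁻¹) := by
  set f : ℕ → ℝ := fun n => (χ.zetaMul n).re * (n : ℝ) ^ (-s) with hf
  have hf1 : f 1 = 1 := by simp [hf, zetaMul_one_re]
  have hmul : ∀ {m n : ℕ}, m.Coprime n → f (m * n) = f m * f n := by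
    intro m n hmn
    simp only [hf]
    rw [zetaMul_re_mul χ hχ hmn, Nat.cast_mul,
      Real.mul_rpow (Nat.cast_nonneg m) (Nat.cast_nonneg n)]
    ring
  have hsum : ∀ {p : ℕ}, p.Prime → Summable (fun n : ℕ => ‖f (p ^ n)‖) := by
    intro p hp
    have h := hasSum_zetaMul_prime_pow χ hχ hp hs
    have hnn : ∀ n, 0 ≤ f (p ^ n) := fun n =>
      mul_nonneg (zetaMul_re_nonneg χ hχ _) (Real.rpow_nonneg (Nat.cast_nonneg _) _)
    have : (fun n : ℕ => ‖f (p ^ n)‖) = fun n => f (p ^ n) := by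
      funext n; rw [Real.norm_eq_abs, abs_of_nonneg (hnn n)]
    rw [this]
    exact h.summable
  have h := (EulerProduct.summable_and_hasSum_smoothNumbers_prod_primesBelow_tsum hf1 hmul hsum M).2
  have hfac : ∀ p ∈ M.primesBelow, ∑' n : ℕ, f (p ^ n) =
      (1 - (p : ℝ) ^ (-s))⁻¹ * (1 - (χ p).re * (p : ℝ) ^ (-s))⁻¹ := fun p hp =>
    (hasSum_zetaMul_prime_pow χ hχ (Nat.prime_of_mem_primesBelow hp) hs).tsum_eq
  rw [prod_congr rfl hfac] at h
  exact h

/-! ### Lower bound: `S(x) ≤ Π₁(M)` for `x < M` -/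

/-- **Lower bound.** For `x < M`: `∑_{n ≤ x} (1 ∗ χ)(n)/n ≤ ∏_{p < M} (1 − 1/p)⁻¹(1 − χ(p)/p)⁻¹`
(each `n ≤ x` is `M`-smooth; all coefficients are `≥ 0`). [folklore] -/
theorem sum_le_smoothProduct (hχ : χ ^ 2 = 1) {x M : ℕ} (hxM : x < M) :
    ∑ n ∈ Icc 1 x, (χ.zetaMul n).re / n ≤
      ∏ p ∈ M.primesBelow, (1 - (p : ℝ)⁻¹)⁻¹ * (1 - (χ p).re * (p : ℝ)⁻¹)⁻¹ := by
  have h := hasSum_smooth χ hχ one_pos M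
  simp only [Real.rpow_neg_one] at h
  -- the finite set `{1, …, x}` inside the smooth numbers
  have hmem : ∀ n ∈ Icc 1 x, n ∈ M.smoothNumbers := fun n hn =>
    Nat.mem_smoothNumbers_of_lt (mem_Icc.mp hn).1 (lt_of_le_of_lt (mem_Icc.mp hn).2 hxM)
  set T : Finset M.smoothNumbers := (Icc 1 x).attach.map
    ⟨fun n => ⟨n.1, hmem n.1 n.2⟩, fun a b hab => Subtype.ext (by
      have := congrArg Subtype.val hab; exact this)⟩ with hT
  have hnn : ∀ m : M.smoothNumbers, 0 ≤ (χ.zetaMul m).re * ((m : ℕ) : ℝ)⁻¹ := fun m =>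
    mul_nonneg (zetaMul_re_nonneg χ hχ _) (inv_nonneg.mpr (Nat.cast_nonneg _))
  have hle := sum_le_hasSum T (fun m _ => hnn m) h
  refine le_trans (le_of_eq ?_) hle
  rw [hT, sum_map, ← sum_attach (Icc 1 x)]
  refine sum_congr rfl fun n _ => ?_
  simp [div_eq_mul_inv]

/-! ### Rankin's trick: `Π₁(M) ≤ S(Z) + Z^{−δ} Π_{1−δ}(M)` -/

/-- **Rankin's trick.** For `0 < δ < 1` and `Z ≥ 1`:
`∏_{p<M}(1 − 1/p)⁻¹(1 − χ(p)/p)⁻¹ ≤ ∑_{n ≤ Z} (1 ∗ χ)(n)/n + Z^{−δ} ∏_{p<M}(1 − p^{δ−1})⁻¹(1 − χ(p)p^{δ−1})⁻¹`.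
[folklore] -/
theorem smoothProduct_le_sum_add (hχ : χ ^ 2 = 1) (M : ℕ) {Z : ℕ} (hZ : 1 ≤ Z) {δ : ℝ}
    (hδ0 : 0 < δ) (hδ1 : δ < 1) :
    ∏ p ∈ M.primesBelow, (1 - (p : ℝ)⁻¹)⁻¹ * (1 - (χ p).re * (p : ℝ)⁻¹)⁻¹ ≤
      ∑ n ∈ Icc 1 Z, (χ.zetaMul n).re / n +
        (Z : ℝ) ^ (-δ) * ∏ p ∈ M.primesBelow,
          (1 - (p : ℝ) ^ (-(1 - δ)))⁻¹ * (1 - (χ p).re * (p : ℝ) ^ (-(1 - δ)))⁻¹ := by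
  have h1 := hasSum_smooth χ hχ one_pos M
  simp only [Real.rpow_neg_one] at h1
  have hδ := hasSum_smooth χ hχ (by linarith : 0 < 1 - δ) M
  have hZ0 : (0 : ℝ) < Z := by exact_mod_cast hZ
  -- the comparison function
  set g : M.smoothNumbers → ℝ := fun m =>
    (if (m : ℕ) ≤ Z then (χ.zetaMul m).re * ((m : ℕ) : ℝ)⁻¹ else 0) +
      (Z : ℝ) ^ (-δ) * ((χ.zetaMul m).re * ((m : ℕ) : ℝ) ^ (-(1 - δ))) with hg
  -- pointwise bound
  have hpt : ∀ m : M.smoothNumbers, (χ.zetaMul m).re * ((m : ℕ) : ℝ)⁻¹ ≤ g m := by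
    intro m
    have hm0 : (0 : ℝ) < (m : ℕ) := by
      exact_mod_cast Nat.pos_of_ne_zero (Nat.ne_zero_of_mem_smoothNumbers m.2)
    have ha : 0 ≤ (χ.zetaMul m).re := zetaMul_re_nonneg χ hχ _
    have hsecond : 0 ≤ (Z : ℝ) ^ (-δ) * ((χ.zetaMul m).re * ((m : ℕ) : ℝ) ^ (-(1 - δ))) :=
      mul_nonneg (Real.rpow_nonneg hZ0.le _) (mul_nonneg ha (Real.rpow_nonneg hm0.le _))
    simp only [hg]
    split_ifs with hmZ
    · linarith
    · -- `m > Z`: `m⁻¹ = m^{−δ} m^{−(1−δ)} ≤ Z^{−δ} m^{−(1−δ)}`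
      push Not at hmZ
      have hmZ' : (Z : ℝ) ≤ (m : ℕ) := by exact_mod_cast hmZ.le
      rw [zero_add]
      have hsplit : ((m : ℕ) : ℝ)⁻¹ = ((m : ℕ) : ℝ) ^ (-δ) * ((m : ℕ) : ℝ) ^ (-(1 - δ)) := by
        rw [← Real.rpow_add hm0, ← Real.rpow_neg_one]; ring_nf
      rw [hsplit]
      have hmono : ((m : ℕ) : ℝ) ^ (-δ) ≤ (Z : ℝ) ^ (-δ) :=
        Real.rpow_le_rpow_of_nonpos hZ0 hmZ' (by linarith)
      calc (χ.zetaMul m).re * (((m : ℕ) : ℝ) ^ (-δ) * ((m : ℕ) : ℝ) ^ (-(1 - δ)))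
          = ((m : ℕ) : ℝ) ^ (-δ) * ((χ.zetaMul m).re * ((m : ℕ) : ℝ) ^ (-(1 - δ))) := by ring
        _ ≤ (Z : ℝ) ^ (-δ) * ((χ.zetaMul m).re * ((m : ℕ) : ℝ) ^ (-(1 - δ))) :=
            mul_le_mul_of_nonneg_right hmono (mul_nonneg ha (Real.rpow_nonneg hm0.le _))
  -- the finite set of smooth `m ≤ Z`
  set T : Finset M.smoothNumbers := (Icc 1 Z).subtype (· ∈ M.smoothNumbers) with hT
  have hT_mem : ∀ m : M.smoothNumbers, m ∉ T → ¬ ((m : ℕ) ≤ Z) := by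
    intro m hm hle
    apply hm
    rw [hT, mem_subtype, mem_Icc]
    exact ⟨Nat.pos_of_ne_zero (Nat.ne_zero_of_mem_smoothNumbers m.2), hle⟩
  -- `HasSum g (∑_{m ∈ T} f₁ m + Z^{−δ} Π_{1−δ})`
  have hg1 : HasSum (fun m : M.smoothNumbers =>
      if (m : ℕ) ≤ Z then (χ.zetaMul m).re * ((m : ℕ) : ℝ)⁻¹ else 0)
      (∑ m ∈ T, (χ.zetaMul m).re * ((m : ℕ) : ℝ)⁻¹) := by
    have h : HasSum (fun m : M.smoothNumbers =>
        if (m : ℕ) ≤ Z then (χ.zetaMul m).re * ((m : ℕ) : ℝ)⁻¹ else 0)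
        (∑ m ∈ T, (if (m : ℕ) ≤ Z then (χ.zetaMul m).re * ((m : ℕ) : ℝ)⁻¹ else 0)) :=
      hasSum_sum_of_ne_finset_zero fun m hm => if_neg (hT_mem m hm)
    have hsum : ∑ m ∈ T, (if (m : ℕ) ≤ Z then (χ.zetaMul m).re * ((m : ℕ) : ℝ)⁻¹ else 0) =
        ∑ m ∈ T, (χ.zetaMul m).re * ((m : ℕ) : ℝ)⁻¹ := by
      refine sum_congr rfl fun m hm => if_pos ?_
      rw [hT, mem_subtype, mem_Icc] at hm
      exact hm.2
    rwa [hsum] at h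
  have hg2 := hδ.mul_left ((Z : ℝ) ^ (-δ))
  have hgsum := hg1.add hg2
  have hle := hasSum_le hpt h1 hgsum
  -- compare `∑_{m ∈ T}` with `∑_{n ≤ Z}`
  have hT_le : ∑ m ∈ T, (χ.zetaMul m).re * ((m : ℕ) : ℝ)⁻¹ ≤ ∑ n ∈ Icc 1 Z, (χ.zetaMul n).re / n := by
    rw [hT, Finset.sum_subtype_eq_sum_filter (f := fun n : ℕ => (χ.zetaMul n).re * (n : ℝ)⁻¹)]
    calc ∑ n ∈ (Icc 1 Z).filter (· ∈ M.smoothNumbers), (χ.zetaMul n).re * (n : ℝ)⁻¹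
        ≤ ∑ n ∈ Icc 1 Z, (χ.zetaMul n).re * (n : ℝ)⁻¹ :=
          sum_le_sum_of_subset_of_nonneg (filter_subset _ _) fun n _ _ =>
            mul_nonneg (zetaMul_re_nonneg χ hχ _) (inv_nonneg.mpr (Nat.cast_nonneg _))
      _ = ∑ n ∈ Icc 1 Z, (χ.zetaMul n).re / n := by
          refine sum_congr rfl fun n _ => ?_; rw [div_eq_mul_inv]
  linarith

/-! ### The Rankin factor `Π_{1−δ}(M)/Π₁(M)` is bounded for `δ = 1/log M` -/

/-- `(1 − v)⁻¹ ≤ e^{4(v − a)} (1 − a)⁻¹` for `a ≤ v ≤ 3/4`. [folklore] -/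
theorem inv_one_sub_le_exp_mul {a v : ℝ} (hav : a ≤ v) (hv : v ≤ 3 / 4) :
    (1 - v)⁻¹ ≤ Real.exp (4 * (v - a)) * (1 - a)⁻¹ := by
  have hv1 : 0 < 1 - v := by linarith
  have ha1 : 0 < 1 - a := by linarith
  have key : (1 - a) / (1 - v) ≤ Real.exp (4 * (v - a)) := by
    have h1 : (1 - a) / (1 - v) = 1 + (v - a) / (1 - v) := by field_simp; ring
    have h2 : (v - a) / (1 - v) ≤ 4 * (v - a) := by
      rw [div_le_iff₀ hv1]; nlinarith
    calc (1 - a) / (1 - v) = 1 + (v - a) / (1 - v) := h1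
      _ ≤ 4 * (v - a) + 1 := by linarith
      _ ≤ Real.exp (4 * (v - a)) := Real.add_one_le_exp _
  calc (1 - v)⁻¹ = (1 - a) / (1 - v) * (1 - a)⁻¹ := by field_simp
    _ ≤ Real.exp (4 * (v - a)) * (1 - a)⁻¹ :=
        mul_le_mul_of_nonneg_right key (inv_nonneg.mpr ha1.le)

/-- `(1 − c v)⁻¹ ≤ e^{4(v − a)} (1 − c a)⁻¹` for `c ∈ {0, 1, −1}` and `0 ≤ a ≤ v ≤ 3/4`.
[folklore] -/
theorem inv_one_sub_mul_le_exp_mul {c a v : ℝ} (hc : c = 0 ∨ c = 1 ∨ c = -1) (ha : 0 ≤ a)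
    (hav : a ≤ v) (hv : v ≤ 3 / 4) :
    (1 - c * v)⁻¹ ≤ Real.exp (4 * (v - a)) * (1 - c * a)⁻¹ := by
  have hexp : 1 ≤ Real.exp (4 * (v - a)) := Real.one_le_exp (by linarith)
  rcases hc with rfl | rfl | rfl
  · simp only [zero_mul, sub_zero, inv_one, mul_one]; exact hexp
  · simp only [one_mul]; exact inv_one_sub_le_exp_mul hav hv
  · simp only [neg_mul, one_mul, sub_neg_eq_add]
    have h1 : (1 + v)⁻¹ ≤ (1 + a)⁻¹ := inv_anti₀ (by linarith) (by linarith)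
    have h2 : 0 ≤ (1 + a)⁻¹ := inv_nonneg.mpr (by linarith)
    nlinarith

/-- `e⁴ < 100` (from `e < 2.7182818286`). [folklore] -/
theorem exp_four_lt : Real.exp 4 < 100 := by
  have h := Real.exp_one_lt_d9
  have h0 := (Real.exp_pos 1).le
  have : Real.exp 4 = Real.exp 1 ^ 4 := by rw [← Real.exp_nat_mul]; norm_num
  rw [this]
  calc Real.exp 1 ^ 4 < (2.7182818286 : ℝ) ^ 4 := pow_lt_pow_left₀ h h0 (by norm_num)
    _ < 100 := by norm_num

/-- Numerics of the cut-off `M ≥ 100`: `log M ≥ 4`, so `δ = 1/log M ∈ (0, 1/4]`, and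
`log 4 ≤ (log M)/2`. [folklore] -/
theorem log_ge_of_hundred_le {M : ℕ} (hM : 100 ≤ M) :
    4 ≤ Real.log M ∧ Real.log 4 ≤ Real.log M / 2 := by
  have hM' : (100 : ℝ) ≤ M := by exact_mod_cast hM
  have h4 : 4 ≤ Real.log M := by
    rw [Real.le_log_iff_exp_le (by linarith)]
    exact (exp_four_lt.le).trans hM'
  refine ⟨h4, ?_⟩
  have : Real.log 4 ≤ 2 := by
    rw [Real.log_le_iff_le_exp (by norm_num)]
    have := Real.add_one_le_exp (2 : ℝ)
    nlinarith [Real.add_one_le_exp (1 : ℝ), Real.exp_one_gt_d9,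
      show Real.exp 2 = Real.exp 1 * Real.exp 1 by rw [← Real.exp_add]; norm_num]
  linarith

/-- **The Euler factor at `1 − δ` against the factor at `1`** (`δ = 1/log M`, `M ≥ 100`,
`p < M` prime): `(1 − p^{δ−1})⁻¹(1 − χ(p)p^{δ−1})⁻¹ ≤ exp(16 δ log p/p) (1 − 1/p)⁻¹(1 − χ(p)/p)⁻¹`
(`p^δ ≤ 1 + 2δ log p` as `δ log p ≤ 1`, `p^{δ−1} ≤ 2^{δ}/2 ≤ 3/4`). [folklore] -/
theorem eulerFactor_rankin_le (hχ : χ ^ 2 = 1) {M p : ℕ} (hM : 100 ≤ M) (hp : p.Prime)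
    (hpM : p < M) :
    (1 - (p : ℝ) ^ (-(1 - 1 / Real.log M)))⁻¹ *
        (1 - (χ p).re * (p : ℝ) ^ (-(1 - 1 / Real.log M)))⁻¹ ≤
      Real.exp (16 * (1 / Real.log M) * Real.log p / p) *
        ((1 - (p : ℝ)⁻¹)⁻¹ * (1 - (χ p).re * (p : ℝ)⁻¹)⁻¹) := by
  obtain ⟨hlogM4, -⟩ := log_ge_of_hundred_le hM
  set δ : ℝ := 1 / Real.log M with hδ
  have hlogM0 : 0 < Real.log M := by linarith
  have hδ0 : 0 < δ := by positivity
  have hδ4 : δ ≤ 1 / 4 := by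
    rw [hδ]; exact div_le_div_of_nonneg_left zero_le_one (by norm_num) hlogM4
  have hp2 : (2 : ℝ) ≤ p := by exact_mod_cast hp.two_le
  have hp0 : (0 : ℝ) < p := by linarith
  have hp1 : (1 : ℝ) ≤ p := by linarith
  have hlogp0 : 0 ≤ Real.log p := Real.log_nonneg hp1
  have hpM' : (p : ℝ) ≤ M := by exact_mod_cast hpM.le
  have hlogpM : Real.log p ≤ Real.log M := Real.log_le_log hp0 hpM'
  have hδlogp : δ * Real.log p ≤ 1 := by
    rw [hδ, one_div, inv_mul_le_iff₀ hlogM0]; linarith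
  -- `v = p^{δ−1} = p^δ/p`, `a = 1/p`
  set a : ℝ := (p : ℝ)⁻¹ with ha
  set v : ℝ := (p : ℝ) ^ (-(1 - δ)) with hv
  have hvsplit : v = (p : ℝ) ^ δ * a := by
    rw [hv, ha, show -(1 - δ) = δ + (-1) by ring, Real.rpow_add hp0, Real.rpow_neg_one]
  have ha0 : 0 ≤ a := inv_nonneg.mpr hp0.le
  -- `p^δ ≤ 1 + 2 δ log p`
  have hpδ : (p : ℝ) ^ δ ≤ 1 + 2 * (δ * Real.log p) := by
    rw [Real.rpow_def_of_pos hp0, mul_comm]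
    have habs : |δ * Real.log p| ≤ 1 := by
      rw [abs_of_nonneg (by positivity)]; exact hδlogp
    have h := Real.abs_exp_sub_one_le habs
    rw [abs_of_nonneg (by positivity : 0 ≤ δ * Real.log p)] at h
    linarith [le_abs_self (Real.exp (δ * Real.log p) - 1)]
  have hpδ1 : 1 ≤ (p : ℝ) ^ δ := Real.one_le_rpow hp1 hδ0.le
  have hav : a ≤ v := by
    rw [hvsplit]
    calc a = 1 * a := (one_mul a).symm
      _ ≤ (p : ℝ) ^ δ * a := mul_le_mul_of_nonneg_right hpδ1 ha0
  have hva : v - a ≤ 2 * δ * Real.log p / p := by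
    rw [hvsplit, ha]
    have : (p : ℝ) ^ δ * (p : ℝ)⁻¹ - (p : ℝ)⁻¹ = ((p : ℝ) ^ δ - 1) * (p : ℝ)⁻¹ := by ring
    rw [this, div_eq_mul_inv]
    exact mul_le_mul_of_nonneg_right (by linarith) ha0
  -- `v ≤ 3/4`
  have hv34 : v ≤ 3 / 4 := by
    have h1 : v ≤ (2 : ℝ) ^ (-(1 - δ)) := Real.rpow_le_rpow_of_nonpos two_pos hp2 (by linarith)
    have h2 : (2 : ℝ) ^ (-(1 - δ)) = (2 : ℝ) ^ δ * 2⁻¹ := by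
      rw [show -(1 - δ) = δ + (-1) by ring, Real.rpow_add two_pos, Real.rpow_neg_one]
    have h3 : (2 : ℝ) ^ δ ≤ 3 / 2 := by
      rw [Real.rpow_def_of_pos two_pos, mul_comm]
      have hl2 : Real.log 2 < 1 := by have := Real.log_two_lt_d9; linarith
      have hl2' : 0 < Real.log 2 := Real.log_pos (by norm_num)
      have habs : |δ * Real.log 2| ≤ 1 := by
        rw [abs_of_nonneg (by positivity)]; nlinarith
      have h := Real.abs_exp_sub_one_le habs
      rw [abs_of_nonneg (by positivity : 0 ≤ δ * Real.log 2)] at h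
      have : δ * Real.log 2 ≤ 1 / 4 := by nlinarith
      linarith [le_abs_self (Real.exp (δ * Real.log 2) - 1)]
    rw [h2] at h1
    linarith
  -- the two factors
  have hc := apply_re_trichotomy χ hχ p
  have f1 := inv_one_sub_le_exp_mul hav hv34
  have f2 := inv_one_sub_mul_le_exp_mul hc ha0 hav hv34
  have hva0 : 0 ≤ v - a := by linarith
  have hcv0 : 0 ≤ (1 - (χ p).re * v)⁻¹ := by
    refine inv_nonneg.mpr ?_
    have : (χ p).re * v ≤ 1 * v :=
      mul_le_mul_of_nonneg_right ((le_abs_self _).trans (abs_apply_re_le_one χ p)) (by linarith)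
    linarith
  have h1a0 : 0 ≤ (1 - a)⁻¹ := inv_nonneg.mpr (by linarith)
  calc (1 - v)⁻¹ * (1 - (χ p).re * v)⁻¹
      ≤ (Real.exp (4 * (v - a)) * (1 - a)⁻¹) * (Real.exp (4 * (v - a)) * (1 - (χ p).re * a)⁻¹) :=
        mul_le_mul f1 f2 hcv0 (mul_nonneg (Real.exp_pos _).le h1a0)
    _ = Real.exp (8 * (v - a)) * ((1 - a)⁻¹ * (1 - (χ p).re * a)⁻¹) := by
        rw [show (8 : ℝ) * (v - a) = 4 * (v - a) + 4 * (v - a) by ring, Real.exp_add]; ring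
    _ ≤ Real.exp (16 * δ * Real.log p / p) * ((1 - a)⁻¹ * (1 - (χ p).re * a)⁻¹) := by
        refine mul_le_mul_of_nonneg_right (Real.exp_le_exp.mpr ?_) (mul_nonneg h1a0 ?_)
        · calc 8 * (v - a) ≤ 8 * (2 * δ * Real.log p / p) := by linarith
            _ = 16 * δ * Real.log p / p := by ring
        · refine inv_nonneg.mpr ?_
          have : (χ p).re * a ≤ 1 * a :=
            mul_le_mul_of_nonneg_right ((le_abs_self _).trans (abs_apply_re_le_one χ p)) ha0
          have ha1 : a ≤ 1 / 2 := by rw [ha]; exact inv_anti₀ two_pos hp2 |>.trans (by norm_num)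
          linarith
    _ = _ := by rw [hδ]

/-- **The Rankin factor is bounded**: for `M ≥ 100` and `δ = 1/log M`,
`∏_{p<M}(1 − p^{δ−1})⁻¹(1 − χ(p)p^{δ−1})⁻¹ ≤ e^{24} ∏_{p<M}(1 − 1/p)⁻¹(1 − χ(p)/p)⁻¹`
(factorwise bound and `∑_{p ≤ M} log p/p ≤ log M + log 4 ≤ (3/2) log M`,
`Literature.NumberTheory.LFunctions.MertensBound.sum_log_div_prime_le`). [folklore] -/
theorem smoothProduct_rankin_le (hχ : χ ^ 2 = 1) {M : ℕ} (hM : 100 ≤ M) :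
    ∏ p ∈ M.primesBelow, (1 - (p : ℝ) ^ (-(1 - 1 / Real.log M)))⁻¹ *
        (1 - (χ p).re * (p : ℝ) ^ (-(1 - 1 / Real.log M)))⁻¹ ≤
      Real.exp 24 * ∏ p ∈ M.primesBelow, (1 - (p : ℝ)⁻¹)⁻¹ * (1 - (χ p).re * (p : ℝ)⁻¹)⁻¹ := by
  obtain ⟨hlogM4, hlog4⟩ := log_ge_of_hundred_le hM
  have hlogM0 : 0 < Real.log M := by linarith
  have hδpos : 0 < 1 - 1 / Real.log M := by
    have : 1 / Real.log M ≤ 1 / 4 := div_le_div_of_nonneg_left zero_le_one (by norm_num) hlogM4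
    linarith
  have hfac : ∀ p ∈ M.primesBelow,
      (1 - (p : ℝ) ^ (-(1 - 1 / Real.log M)))⁻¹ * (1 - (χ p).re * (p : ℝ) ^ (-(1 - 1 / Real.log M)))⁻¹ ≤
        Real.exp (16 * (1 / Real.log M) * Real.log p / p) *
          ((1 - (p : ℝ)⁻¹)⁻¹ * (1 - (χ p).re * (p : ℝ)⁻¹)⁻¹) := fun p hp =>
    eulerFactor_rankin_le χ hχ hM (Nat.prime_of_mem_primesBelow hp) (Nat.lt_of_mem_primesBelow hp)
  have hpos : ∀ p ∈ M.primesBelow,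
      0 ≤ (1 - (p : ℝ) ^ (-(1 - 1 / Real.log M)))⁻¹ * (1 - (χ p).re * (p : ℝ) ^ (-(1 - 1 / Real.log M)))⁻¹ :=
    fun p hp => (eulerFactor_pos χ (Nat.prime_of_mem_primesBelow hp) hδpos).le
  refine (prod_le_prod hpos hfac).trans ?_
  rw [prod_mul_distrib, ← Real.exp_sum]
  have h1 : ∀ p ∈ M.primesBelow, 0 ≤ (1 - (p : ℝ)⁻¹)⁻¹ * (1 - (χ p).re * (p : ℝ)⁻¹)⁻¹ := by
    intro p hp
    have := (eulerFactor_pos χ (Nat.prime_of_mem_primesBelow hp) one_pos).le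
    simpa only [Real.rpow_neg_one] using this
  refine mul_le_mul_of_nonneg_right (Real.exp_le_exp.mpr ?_) (prod_nonneg h1)
  -- `16 δ ∑_{p<M} log p/p ≤ 16 δ (log M + log 4) ≤ 24`
  have hsum : ∑ p ∈ M.primesBelow, Real.log p / p ≤ Real.log M + Real.log 4 := by
    refine le_trans ?_ (Literature.NumberTheory.LFunctions.MertensBound.sum_log_div_prime_le M)
    refine sum_le_sum_of_subset_of_nonneg ?_ fun p hp _ => ?_
    · intro p hp
      rw [Nat.primesLE, Nat.mem_primesBelow]
      obtain ⟨h1, h2⟩ := Nat.mem_primesBelow.mp hp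
      exact ⟨by omega, h2⟩
    · have hp1 : (1 : ℝ) ≤ p := by exact_mod_cast (Nat.prime_of_mem_primesLE hp).one_lt.le
      exact div_nonneg (Real.log_nonneg hp1) (by linarith)
  calc ∑ p ∈ M.primesBelow, 16 * (1 / Real.log M) * Real.log p / p
      = 16 * (1 / Real.log M) * ∑ p ∈ M.primesBelow, Real.log p / p := by
        rw [mul_sum]; refine sum_congr rfl fun p _ => ?_; ring
    _ ≤ 16 * (1 / Real.log M) * (Real.log M + Real.log 4) :=
        mul_le_mul_of_nonneg_left hsum (by positivity)
    _ ≤ 16 * (1 / Real.log M) * (Real.log M + Real.log M / 2) := by gcongr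
    _ = 24 := by field_simp; ring

/-! ### The upper bound used downstream -/

/-- **Upper bound.** For a quadratic character `χ`, `M ≥ 100` and `Z ≥ 1`:
`∏_{p<M}(1 − 1/p)⁻¹(1 − χ(p)/p)⁻¹ ≤ ∑_{n ≤ Z} (1 ∗ χ)(n)/n + e^{24} Z^{−1/log M} ∏_{p<M}(1 − 1/p)⁻¹(1 − χ(p)/p)⁻¹`.
With `Z = M^u` the last factor is `e^{24−u}`: the truncated Euler product at `1` is controlled by the
divisor-sum mean up to `M^u`. [folklore] -/
theorem smoothProduct_le_sum_add_exp (hχ : χ ^ 2 = 1) {M : ℕ} (hM : 100 ≤ M) {Z : ℕ} (hZ : 1 ≤ Z) :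
    ∏ p ∈ M.primesBelow, (1 - (p : ℝ)⁻¹)⁻¹ * (1 - (χ p).re * (p : ℝ)⁻¹)⁻¹ ≤
      ∑ n ∈ Icc 1 Z, (χ.zetaMul n).re / n +
        Real.exp 24 * (Z : ℝ) ^ (-(1 / Real.log M)) *
          ∏ p ∈ M.primesBelow, (1 - (p : ℝ)⁻¹)⁻¹ * (1 - (χ p).re * (p : ℝ)⁻¹)⁻¹ := by
  obtain ⟨hlogM4, -⟩ := log_ge_of_hundred_le hM
  have hδ0 : 0 < 1 / Real.log M := by positivity
  have hδ1 : 1 / Real.log M < 1 := by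
    rw [div_lt_one (by linarith)]; linarith
  have h1 := smoothProduct_le_sum_add χ hχ M hZ hδ0 hδ1
  have h2 := smoothProduct_rankin_le χ hχ hM
  have hZ0 : 0 ≤ (Z : ℝ) ^ (-(1 / Real.log M)) := Real.rpow_nonneg (Nat.cast_nonneg _) _
  have h3 := mul_le_mul_of_nonneg_left h2 hZ0
  calc _ ≤ _ := h1
    _ ≤ _ := by rw [mul_assoc, mul_left_comm]; linarith

end Literature.NumberTheory.LFunctions.SmoothEulerProduct
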